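/-
COR-CM (cell pub-hodgecm2, stage 2 of the Hodge ladder) — count-neutral kernel combinatorics (seat prover-pub-hodgecm2-b23-g40-0, binder
prover b23, gen 40; claim COMPLEMENT-FACES F3, HOME/INBOX.md l.9766; sequel of `Census/ComplementFacesSquares.lean`).  One bookkeeping
definition with body (`weil`, the Weil vector of the complement) + theorems, in seat b09's intrinsic model (`CMF G c`, `rt`, `oflipCM`,
`typeSum`, `pair`/`pairSet`, `translates`, `hodgeSpan`, `cplT` — consumed BY NAME, nothing restated); no certificate, no `decide`, no named
fact, no geometry, no `sorry`.  `Interfaces.lean` (C1), every E term, B01 and `Transposition/*` are untouched.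
HONEST FRAMING: `HC_CM` is NOT proved, here or anywhere in the tree; nothing here is a period or a headline.
-/
import Summits.HodgeConjecture.CorCM.Census.ComplementFacesSquares

/-!
# Faces of a complemented Galois CM type, III: the Weil vector, the reduced Hodge vectors, invariant functionals

CONTENT (setting of parts I–II: `G` finite, `c` a central involution, `A` a complement, `T = cplT`, `n = |A|`).
* §1 **The Weil vector** `weil T = Σ_{d ∈ T} [T^{(d)}] − (n − 2)·[T]` (the class of `E^{n−2} × B₁` in the abelian slice files): it has
  constant type sum `1` (`typeSum_weil`), so it is a Hodge vector (`weil_mem_hodgeSpan`).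
* §2 **KEY LEMMA** (`eq_zero_of_reduced`, `eq_smul_weil`): a vector supported on the types of weight `≤ 1` (`T` and the `T^{(d)}`) with
  constant type sum `k` IS `k·weil` — read the type sum at `c·d` (only `T^{(d)}` sees it) and at a place of `T`.
* §3 With part II's reduction: **`hodgeSpan ≤ ℤ⟨pairs⟩ ⊔ ℤ⟨base changes of the canonical squares⟩ ⊔ ℤ·weil`** for EVERY complemented central
  involution (`hodgeSpan_le_rel_sup_weil`), in the class-bounded form `exists_sub_smul_weil_mem` used by the closings of part IV: a Hodge
  vector supported in level `≤ 2m + 1` is `≡ k·weil` modulo pairs and base changes of squares of class `≤ m`.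
* §4 **Invariant functionals**: a weight function `f` kept by base change along `A` and negated by conjugation gives a functional
  `Σ_Ψ f(Ψ)·y(Ψ)` that kills the pairs and changes at most by a sign under base change; if it kills a set `S` of relations it kills
  `ℤ⟨pairs⟩ ⊔ ℤ⟨base changes of S⟩` (`lc_eq_zero_of_mem`).  Part IV feeds it the signed weight (`n` odd) and the sign (`n` even).
No commutativity of `A` is used.  All [folklore] bookkeeping over [Pohlmann1968, Thm 1] in the reading of [Milne1999, Prop. 2.1];
the Weil vector is [Weil1977HodgeRing]'s class in this labelling.

## References
* [Pohlmann1968] H. Pohlmann, Algebraic cycles on abelian varieties of complex multiplication type, Ann. of Math. 88 (1968), Thm 1.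
* [Milne1999] J. S. Milne, Lefschetz motives and the Tate conjecture, Compositio Math. 117 (1999), Prop. 2.1, p. 54.
* [Weil1977HodgeRing] A. Weil, Abelian varieties and the Hodge ring, Œuvres Scientifiques III, [1977c], 421–429.
-/

namespace Summit.HodgeConjecture.CorCM.Census.ComplementFaces

open Finset
open scoped symmDiff
open Summit.HodgeConjecture.CorCM.Prior.AllgGroup.RfwfAllgGroup
open Summit.HodgeConjecture.CorCM.Census.BlockParity
open Summit.HodgeConjecture.CorCM.Census.Coinvariant

noncomputable section

variable {G : Type*} [Group G] [Fintype G] [DecidableEq G] (c : G)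

/-! ## §1 The Weil vector of a base type -/

/-- **The Weil vector** of the base type `T`: `Σ_{d ∈ T} [T^{(d)}] − (|T| − 2)·[T]`. [folklore] -/
def weil (hc2 : c * c = 1) (T : CMF G c) : CMF G c →₀ ℤ :=
  (∑ d ∈ T.1, Finsupp.single (oflipCM c hc2 d T) 1) - ((T.1.card : ℤ) - 2) • Finsupp.single T 1

/-- The indicator of a single flip `T^{(d)}` at a place `x ∈ T`: `0` at `x = d`, `1` elsewhere. [folklore] -/
theorem indG_oflipCM_self_of_mem (hc2 : c * c = 1) {T : CMF G c} {d x : G} (hd : d ∈ T.1) (hx : x ∈ T.1) :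
    indG (oflipCM c hc2 d T).1 x = if x = d then 0 else 1 := by
  change indG (oflip c d T.1) x = _
  by_cases hxd : x = d
  · rw [if_pos hxd, indG_oflip_of_mem c ((mem_orb c).mpr (Or.inl hxd))]
    simp [indG, hx]
  · have hxo : x ∉ orb c d := by
      rw [mem_orb]; rintro (h | h)
      · exact hxd h
      · exact (T.2 d).mp hd (h ▸ hx)
    rw [if_neg hxd, indG_oflip_of_not_mem c hxo]
    simp [indG, hx]

/-- The indicator of a single flip `T^{(d)}` off `T`: `1` at `x = c·d`, `0` elsewhere. [folklore] -/
theorem indG_oflipCM_self_of_notMem (hc2 : c * c = 1) {T : CMF G c} {d x : G} (hd : d ∈ T.1) (hx : x ∉ T.1) :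
    indG (oflipCM c hc2 d T).1 x = if c * x = d then 1 else 0 := by
  change indG (oflip c d T.1) x = _
  by_cases hxd : c * x = d
  · have hxo : x ∈ orb c d := (mem_orb c).mpr (Or.inr (by rw [← hxd, cmul_cmul c hc2]))
    rw [if_pos hxd, indG_oflip_of_mem c hxo]
    simp [indG, hx]
  · have hxo : x ∉ orb c d := by
      rw [mem_orb]; rintro (h | h)
      · exact hx (h ▸ hd)
      · exact hxd (by rw [h, cmul_cmul c hc2])
    rw [if_neg hxd, indG_oflip_of_not_mem c hxo]
    simp [indG, hx]

/-- **The Weil vector has constant type sum `1`.** [folklore] -/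
theorem typeSum_weil (hc2 : c * c = 1) (T : CMF G c) (x : G) : typeSum G c (weil c hc2 T) x = 1 := by
  simp only [weil, map_sub, map_sum, map_smul, typeSum_single, Pi.sub_apply, Pi.smul_apply, Finset.sum_apply, smul_eq_mul]
  by_cases hx : x ∈ T.1
  · have hT : indG T.1 x = 1 := by simp [indG, hx]
    have hsum : ∑ d ∈ T.1, indG (oflipCM c hc2 d T).1 x = (T.1.card : ℤ) - 1 := by
      rw [Finset.sum_congr rfl fun d hd => indG_oflipCM_self_of_mem c hc2 hd hx, ← Finset.sum_erase_add _ _ hx, if_pos rfl,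
        add_zero, Finset.sum_congr rfl fun d hd => if_neg (ne_of_mem_erase hd).symm, Finset.sum_const, card_erase_of_mem hx,
        nsmul_eq_mul, mul_one, Nat.cast_sub (card_pos.mpr ⟨x, hx⟩), Nat.cast_one]
    rw [hsum, hT]; ring
  · have hT : indG T.1 x = 0 := by simp [indG, hx]
    have hcx : c * x ∈ T.1 := by by_contra h; exact hx ((T.2 x).mpr h)
    have hsum : ∑ d ∈ T.1, indG (oflipCM c hc2 d T).1 x = 1 := by
      rw [Finset.sum_congr rfl fun d hd => indG_oflipCM_self_of_notMem c hc2 hd hx, Finset.sum_ite_eq, if_pos hcx]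
    rw [hsum, hT]; ring

/-- **The Weil vector is a Hodge vector** (central `c ≠ 1`). [folklore] -/
theorem weil_mem_hodgeSpan (hc2 : c * c = 1) (hc1 : c ≠ 1) (hcen : ∀ x : G, x * c = c * x) (T : CMF G c) :
    weil c hc2 T ∈ hodgeSpan c hc2 :=
  mem_hodgeSpan_of_forall_typeSum_eq c hc2 hc1 hcen (typeSum_weil c hc2 T)

/-- The Weil vector is supported on the types of weight `≤ 1`. [folklore] -/
theorem weil_apply_eq_zero_of_two_le_wt (hc2 : c * c = 1) (T : CMF G c) {Ψ : CMF G c} (h : 2 ≤ wt c T Ψ) :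
    weil c hc2 T Ψ = 0 := by
  rw [weil, Finsupp.sub_apply, Finsupp.finsetSum_apply, Finsupp.smul_apply, Finsupp.single_apply, if_neg, smul_zero, sub_zero]
  · refine Finset.sum_eq_zero fun d hd => ?_
    rw [Finsupp.single_apply, if_neg]
    intro h'
    rw [← h', wt_oflipCM_self c hc2 hd] at h
    omega
  · intro h'
    rw [← h', wt_self] at h
    omega

/-! ## §2 The key lemma: reduced Hodge vectors are multiples of the Weil vector -/

/-- **KEY LEMMA.**  A vector supported on the types of weight `≤ 1` with type sum `0` vanishes. [folklore] -/
theorem eq_zero_of_reduced (hc2 : c * c = 1) (T : CMF G c) (hT : T.1.Nonempty) (z : CMF G c →₀ ℤ)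
    (hz : ∀ Ψ ∈ z.support, wt c T Ψ ≤ 1) (h0 : ∀ x : G, typeSum G c z x = 0) : z = 0 := by
  classical
  have hts : ∀ x : G, typeSum G c z x = ∑ Φ ∈ z.support, z Φ * indG Φ.1 x := by
    intro x
    unfold typeSum
    rw [Finsupp.lsum_apply, Finsupp.sum, Finset.sum_apply]
    exact Finset.sum_congr rfl fun Φ _ => by rw [LinearMap.toSpanSingleton_apply, Pi.smul_apply, smul_eq_mul]
  -- the support consists of `T` and single flips `T^{(d)}`
  have hcase : ∀ Φ ∈ z.support, Φ = T ∨ ∃ d ∈ T.1, Φ = oflipCM c hc2 d T := by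
    intro Φ hΦ
    rcases Nat.le_one_iff_eq_zero_or_eq_one.mp (hz Φ hΦ) with h | h
    · exact Or.inl (eq_of_wt_eq_zero c h)
    · exact Or.inr (exists_eq_oflipCM_of_wt_eq_one c hc2 h)
  -- (1) the coefficient of every single flip vanishes: read the type sum at `c·d`
  have hflip : ∀ d ∈ T.1, z (oflipCM c hc2 d T) = 0 := by
    intro d hd
    have hcd : c * d ∉ T.1 := (T.2 d).mp hd
    have key : ∀ Φ ∈ z.support, z Φ * indG Φ.1 (c * d) = if Φ = oflipCM c hc2 d T then z Φ else 0 := by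
      intro Φ hΦ
      rcases hcase Φ hΦ with rfl | ⟨d', hd', rfl⟩
      · rw [if_neg (oflipCM_self_ne c hc2 hd).symm]
        simp [indG, hcd]
      · rw [indG_oflipCM_self_of_notMem c hc2 hd' hcd, cmul_cmul c hc2]
        by_cases hdd : d = d'
        · subst hdd; rw [if_pos rfl, if_pos rfl, mul_one]
        · rw [if_neg hdd, if_neg (fun h => hdd (oflipCM_self_injOn c hc2 hd' hd h).symm), mul_zero]
    have h := h0 (c * d)
    rw [hts, Finset.sum_congr rfl key, Finset.sum_ite_eq'] at h
    by_cases hmem : oflipCM c hc2 d T ∈ z.support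
    · rwa [if_pos hmem] at h
    · exact Finsupp.notMem_support_iff.mp hmem
  -- (2) the coefficient of `T` vanishes: read the type sum at a place of `T`
  obtain ⟨x₀, hx₀⟩ := hT
  have hbase : z T = 0 := by
    have key : ∀ Φ ∈ z.support, z Φ * indG Φ.1 x₀ = if Φ = T then z Φ else 0 := by
      intro Φ hΦ
      rcases hcase Φ hΦ with rfl | ⟨d', hd', rfl⟩
      · simp [indG, hx₀]
      · rw [if_neg (oflipCM_self_ne c hc2 hd'), hflip d' hd', zero_mul]
    have h := h0 x₀
    rw [hts, Finset.sum_congr rfl key, Finset.sum_ite_eq'] at h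
    by_cases hmem : T ∈ z.support
    · rwa [if_pos hmem] at h
    · exact Finsupp.notMem_support_iff.mp hmem
  -- (3) conclude
  ext Φ
  by_cases hΦ : Φ ∈ z.support
  · rcases hcase Φ hΦ with rfl | ⟨d, hd, rfl⟩
    · exact hbase
    · exact hflip d hd
  · exact Finsupp.notMem_support_iff.mp hΦ

/-- **A reduced vector with constant type sum `k` is `k·weil`.** [folklore] -/
theorem eq_smul_weil (hc2 : c * c = 1) (T : CMF G c) (hT : T.1.Nonempty) (y : CMF G c →₀ ℤ)
    (hy : ∀ Ψ ∈ y.support, wt c T Ψ ≤ 1) {k : ℤ} (hk : ∀ x : G, typeSum G c y x = k) : y = k • weil c hc2 T := by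
  refine sub_eq_zero.mp (eq_zero_of_reduced c hc2 T hT (y - k • weil c hc2 T) (fun Ψ hΨ => ?_) fun x => ?_)
  · by_contra hw
    have h2 : 2 ≤ wt c T Ψ := by omega
    have h1 : y Ψ = 0 := Finsupp.notMem_support_iff.mp fun h => absurd (hy Ψ h) (by omega)
    rw [Finsupp.mem_support_iff, Finsupp.sub_apply, Finsupp.smul_apply, h1, weil_apply_eq_zero_of_two_le_wt c hc2 T h2,
      smul_zero, sub_zero] at hΨ
    exact hΨ rfl
  · rw [map_sub, map_smul, Pi.sub_apply, Pi.smul_apply, hk, typeSum_weil, smul_eq_mul, mul_one, sub_self]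

/-! ## §3 The Hodge span modulo pairs and squares is spanned by the Weil vector -/

section Complement

variable {A : Subgroup G} (hA : ∀ x : G, x ∈ A ↔ c * x ∉ A)

/-- A relation is among its own base changes (`Q = 1`). [folklore] -/
theorem mem_translates_of_mem {S : Finset (CMF G c →₀ ℤ)} {s : CMF G c →₀ ℤ} (hs : s ∈ S) : s ∈ translates c S :=
  ⟨1, s, hs, (mapDomain_rt_one c s).symm⟩

/-- `translates` is monotone in the family. [folklore] -/
theorem translates_mono {S S' : Finset (CMF G c →₀ ℤ)} (h : S ⊆ S') : translates c S ⊆ translates c S' := by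
  rintro _ ⟨Q, s, hs, rfl⟩
  exact ⟨Q, s, h hs, rfl⟩

/-- `ℤ⟨pairs⟩ ⊔ ℤ⟨base changes of S⟩` is monotone in `S`. [folklore] -/
theorem rel_mono {S S' : Finset (CMF G c →₀ ℤ)} (h : S ⊆ S') :
    Submodule.span ℤ (pairSet c) ⊔ Submodule.span ℤ (translates c S) ≤
      Submodule.span ℤ (pairSet c) ⊔ Submodule.span ℤ (translates c S') :=
  sup_le_sup_left (Submodule.span_mono (translates_mono c h)) _

/-- Base changes of face relations are Hodge vectors. [folklore] -/
theorem span_translates_le_hodgeSpan (hc2 : c * c = 1) (hcen : ∀ x : G, x * c = c * x) (S : Finset (CMF G c →₀ ℤ))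
    (hS : (↑S : Set (CMF G c →₀ ℤ)) ⊆ gfaceSet G c hc2) : Submodule.span ℤ (translates c S) ≤ hodgeSpan c hc2 := by
  rw [Submodule.span_le]
  rintro _ ⟨Q, s, hs, rfl⟩
  exact mapDomain_rt_mem_hodgeSpan c hc2 hcen Q (gfaceSet_subset_hodgeSpan c hc2 (hS (mem_coe.mpr hs)))

/-- `ℤ⟨pairs⟩ ⊔ ℤ⟨base changes of the canonical squares⟩ ≤ hodgeSpan`. [folklore] -/
theorem rel_le_hodgeSpan (hc2 : c * c = 1) (hcen : ∀ x : G, x * c = c * x) (m : ℕ) :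
    Submodule.span ℤ (pairSet c) ⊔ Submodule.span ℤ (translates c (squaresLE c hA hc2 hcen m)) ≤ hodgeSpan c hc2 :=
  sup_le (Submodule.span_le.mpr fun _ ⟨Ψ, h⟩ => h ▸ pair_mem_hodgeSpan c hc2 Ψ)
    (span_translates_le_hodgeSpan c hc2 hcen _ (squaresLE_subset_gfaceSet c hA hc2 hcen m))

/-- **A Hodge vector supported in level `≤ 2m + 1` is `≡ k·weil` modulo pairs and base changes of the canonical squares of class `≤ m`.**
[folklore] -/
theorem exists_sub_smul_weil_mem (hc2 : c * c = 1) (hcen : ∀ x : G, x * c = c * x) (m : ℕ) {z : CMF G c →₀ ℤ}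
    (hz : z ∈ hodgeSpan c hc2) (hlvl : ∀ Ψ ∈ z.support, lvl c (cplT c A hA) Ψ ≤ 2 * m + 1) :
    ∃ k : ℤ, z - k • weil c hc2 (cplT c A hA) ∈
      Submodule.span ℤ (pairSet c) ⊔ Submodule.span ℤ (translates c (squaresLE c hA hc2 hcen m)) := by
  obtain ⟨y', hy', hred⟩ := exists_reduced c hA hc2 hcen m z hlvl
  have hy'H : y' ∈ hodgeSpan c hc2 := by
    have h := Submodule.sub_mem _ hz (rel_le_hodgeSpan c hA hc2 hcen m hy')
    rwa [sub_sub_cancel] at h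
  obtain ⟨k, hk⟩ := exists_forall_typeSum_eq_of_mem_hodgeSpan c hc2 hcen hy'H
  refine ⟨k, ?_⟩
  rw [← eq_smul_weil c hc2 (cplT c A hA) ⟨1, (mem_cplT c hA 1).mpr A.one_mem⟩ y' hred hk]
  exact hy'

/-- **`hodgeSpan ≤ ℤ⟨pairs⟩ ⊔ ℤ⟨base changes of the canonical squares⟩ ⊔ ℤ·weil`** for every complemented central involution — modulo
pairs and the (at most `β − 2`) canonical squares the Hodge lattice is cyclic, generated by the Weil vector. [folklore] -/
theorem hodgeSpan_le_rel_sup_weil (hc2 : c * c = 1) (hcen : ∀ x : G, x * c = c * x) :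
    hodgeSpan c hc2 ≤ (Submodule.span ℤ (pairSet c) ⊔
        Submodule.span ℤ (translates c (squaresLE c hA hc2 hcen ((cplT c A hA).1.card / 2)))) ⊔
      Submodule.span ℤ {weil c hc2 (cplT c A hA)} := by
  intro z hz
  obtain ⟨k, hk⟩ := exists_sub_smul_weil_mem c hA hc2 hcen _ hz fun Ψ _ => lvl_le_card c _ Ψ
  have e : z = (z - k • weil c hc2 (cplT c A hA)) + k • weil c hc2 (cplT c A hA) := by abel
  rw [e]
  exact Submodule.add_mem _ (Submodule.mem_sup_left hk)
    (Submodule.mem_sup_right (Submodule.smul_mem _ _ (Submodule.subset_span rfl)))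

/-! ## §4 Invariant functionals -/

include hA in
/-- A weight function kept by base change along `A` and negated by conjugation gives a functional `Σ_Ψ f(Ψ)·y(Ψ)` changing at most by a
sign under ANY base change (`Q ∈ A` keeps it, `Q = c·a` negates it). [folklore] -/
theorem lc_mapDomain_rt_eq_or (hc2 : c * c = 1) {f : CMF G c → ℤ} (hfa : ∀ a ∈ A, ∀ Ψ, f (rt c a Ψ) = f Ψ)
    (hfc : ∀ Ψ, f (rt c c Ψ) = -f Ψ) (Q : G) (v : CMF G c →₀ ℤ) :
    Finsupp.linearCombination ℤ f (Finsupp.mapDomain (rt c Q) v) = Finsupp.linearCombination ℤ f v ∨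
      Finsupp.linearCombination ℤ f (Finsupp.mapDomain (rt c Q) v) = -Finsupp.linearCombination ℤ f v := by
  rw [Finsupp.linearCombination_mapDomain]
  by_cases hQ : Q ∈ A
  · left
    have hf : f ∘ rt c Q = f := funext fun Ψ => hfa Q hQ Ψ
    rw [hf]
  · right
    have hcQ : c * Q ∈ A := cmul_mem_cpl c hA hQ
    have hf : f ∘ rt c Q = -f := by
      funext Ψ
      simp only [Function.comp_apply, Pi.neg_apply]
      conv_lhs => rw [← cmul_cmul c hc2 Q, rt_mul]
      rw [hfc, hfa _ hcQ]
    rw [hf]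
    simp only [Finsupp.linearCombination_apply, Finsupp.sum, Pi.neg_apply, smul_neg, Finset.sum_neg_distrib]

/-- Such a functional is **kept by base change along `A`**. [folklore] -/
theorem lc_mapDomain_rt_of_mem {f : CMF G c → ℤ} (hfa : ∀ a ∈ A, ∀ Ψ, f (rt c a Ψ) = f Ψ) {a : G} (ha : a ∈ A)
    (v : CMF G c →₀ ℤ) : Finsupp.linearCombination ℤ f (Finsupp.mapDomain (rt c a) v) = Finsupp.linearCombination ℤ f v := by
  rw [Finsupp.linearCombination_mapDomain]
  have hf : f ∘ rt c a = f := funext fun Ψ => hfa a ha Ψ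
  rw [hf]

/-- Such a functional **kills the pairs**. [folklore] -/
theorem lc_pair {f : CMF G c → ℤ} (hfc : ∀ Ψ, f (rt c c Ψ) = -f Ψ) (Ψ : CMF G c) :
    Finsupp.linearCombination ℤ f (pair c Ψ) = 0 := by
  rw [pair, map_add, Finsupp.linearCombination_single, Finsupp.linearCombination_single, hfc, one_smul, one_smul, add_neg_cancel]

include hA in
/-- Such a functional **killing a set `S` of relations kills `ℤ⟨pairs⟩ ⊔ ℤ⟨base changes of S⟩`**. [folklore] -/
theorem lc_eq_zero_of_mem (hc2 : c * c = 1) {f : CMF G c → ℤ} (hfa : ∀ a ∈ A, ∀ Ψ, f (rt c a Ψ) = f Ψ)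
    (hfc : ∀ Ψ, f (rt c c Ψ) = -f Ψ) (S : Finset (CMF G c →₀ ℤ)) (hS : ∀ s ∈ S, Finsupp.linearCombination ℤ f s = 0)
    {v : CMF G c →₀ ℤ} (hv : v ∈ Submodule.span ℤ (pairSet c) ⊔ Submodule.span ℤ (translates c S)) :
    Finsupp.linearCombination ℤ f v = 0 := by
  have hP : Submodule.span ℤ (pairSet c) ≤ LinearMap.ker (Finsupp.linearCombination ℤ f) := by
    rw [Submodule.span_le]
    rintro _ ⟨Ψ, rfl⟩
    exact LinearMap.mem_ker.mpr (lc_pair c hfc Ψ)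
  have hN : Submodule.span ℤ (translates c S) ≤ LinearMap.ker (Finsupp.linearCombination ℤ f) := by
    rw [Submodule.span_le]
    rintro _ ⟨Q, s, hs, rfl⟩
    rw [SetLike.mem_coe, LinearMap.mem_ker]
    rcases lc_mapDomain_rt_eq_or c hA hc2 hfa hfc Q s with h | h
    · rw [h, hS s hs]
    · rw [h, hS s hs, neg_zero]
  exact LinearMap.mem_ker.mp (sup_le hP hN hv)

/-- The functional on the Weil vector: `Σ_{d ∈ T} f(T^{(d)}) − (n − 2)·f(T)`. [folklore] -/
theorem lc_weil (hc2 : c * c = 1) (f : CMF G c → ℤ) (T : CMF G c) :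
    Finsupp.linearCombination ℤ f (weil c hc2 T) = (∑ d ∈ T.1, f (oflipCM c hc2 d T)) - ((T.1.card : ℤ) - 2) * f T := by
  rw [weil, map_sub, map_sum, map_smul, Finsupp.linearCombination_single, smul_eq_mul, smul_eq_mul, one_mul]
  congr 1
  exact Finset.sum_congr rfl fun d _ => by rw [Finsupp.linearCombination_single, one_smul]

/-- The functional on a face relation: `f(Φ) + f(Φ^{(tt')}) − f(Φ^{(t)}) − f(Φ^{(t')})`. [folklore] -/
theorem lc_gface (hc2 : c * c = 1) (f : CMF G c → ℤ) (Φ : CMF G c) (t t' : G) :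
    Finsupp.linearCombination ℤ f (gface c hc2 Φ t t') =
      f Φ + f (oflipCM c hc2 t (oflipCM c hc2 t' Φ)) - f (oflipCM c hc2 t Φ) - f (oflipCM c hc2 t' Φ) := by
  rw [gface, map_sub, map_sub, map_add, Finsupp.linearCombination_single, Finsupp.linearCombination_single,
    Finsupp.linearCombination_single, Finsupp.linearCombination_single, one_smul, one_smul, one_smul, one_smul]

end Complement

end

end Summit.HodgeConjecture.CorCM.Census.ComplementFaces
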